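import Summits.BirchSwinnertonDyer.BirchSwinnertonDyer.Theorems.ManinLocalTwoThreeEtaIdentitiesOneFortyFour
import Summits.BirchSwinnertonDyer.BirchSwinnertonDyer.Theorems.ManinLocalTwoThreeNeronSqueeze
import Summits.BirchSwinnertonDyer.Rank1Residual.Additive.IntModelConductorCertificate
import HarnessLib

/-!
# Level 144, class `144a`: the Néron squeeze for `144a1 = [0, 0, 0, 0, −1]` — `|c| = 1` for every `X₀(144)`-datum whose newform is
# `φ₁₄₄ₐ = η₁₂¹²/(η₆η₂₄)⁴`; `N(144a1) = 144` in the kernel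

Cell bsd-f2-manin, route `ManinLocalTwoThree` (cruxes C2 `ManinOddAtFour` stmt-22967 AND C3 `ManinPrimeToThreeAtNine` stmt-22968;
`144 = 2⁴·3²` in both domains), prover seat p3 gen 24; level-`144` instance (class `144a`) of the general NÉRON SQUEEZE
(`NeronSqueeze.abs_maninConstant_eq_one_of_periodLattice_le`) fed with (S2)₁₄₄ₐ of `EtaIdentitiesOneFortyFour` (UNCONDITIONAL, E₂ road).

* §1 `144a1 = [0, 0, 0, 0, −1] : y² = x³ − 1`: elliptic, globally minimal (`Δ = −2⁴3³`), **`N(144a1) = 144`** by kernel Tate certificates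
  (type `II` at `2`: `(r, s, t) = (0, 0, 1)` to `[0, 0, 2, 0, −2]`, `2 ∥ a₆`, `f₂ = 4`; type `III` at `3`: `(r, s, t) = (1, 0, 0)` to `[0, 3, 0, 3, 0]`,
  `9 ∣ a₆`, `3² ∥ b₈ = −9`, `f₃ = 2`), Néron invariants `(c₄/12, c₆/216) = (0, 4)`;
* §2 **`abs_maninConstant_eq_one_oneFortyFour_of_f_eq`**: for every globally minimal elliptic `W/ℚ` and every `X₀(144)`-datum `D` of `W` with
  the lattice clause AND `⇑D.f = φ₁₄₄ₐ`: `|c(D)| = 1`, hence `2 ∤ c` and `3 ∤ c`.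

HONEST FRAMING: unconditional (standard axioms), but it covers ONLY the data whose newform is `φ₁₄₄ₐ`: the level-`144` statement needs the
class `144b` and the newform pinning (neither here).  The `∀ N` cruxes C2/C3, Manin's conjecture and BSD are NOT proved; items
22967/22968 stay OPEN as filed.  No definition, no named fact, no sorry.
[cite: AgasheRibetStein2006, §§1–2] [cite: CremonaAlgorithms1997, Table 1 (144a1)] [cite: Silverman1994, IV.9.4] [cite: MartinOno1997, Thm. 2]
-/

set_option autoImplicit false
-- lint-debt: the directory name repeats the summit name (sibling precedent `ManinLocalTwoThreeNeronSqueezeSixtyFour.lean`)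
set_option linter.dupNamespace false

noncomputable section

open Complex Filter Topology Set Function
open UpperHalfPlane hiding I
open scoped Real Topology Manifold MatrixGroups ModularForm
open ModularForm CongruenceSubgroup WeierstrassCurve
open Summit.BirchSwinnertonDyer.BirchSwinnertonDyer.Rank2Observatory
open Summit.BirchSwinnertonDyer.BirchSwinnertonDyer.Rank2Observatory.RootNumber
open Summit.BirchSwinnertonDyer.BirchSwinnertonDyer.Rank2Observatory.Tate
open Summit.BirchSwinnertonDyer.Rank1Residual.Additive
open Literature.NumberTheory.EllipticCurves Literature.NumberTheory.EllipticCurves.ModularForms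
open Literature.NumberTheory.Automorphic

namespace Summit.BirchSwinnertonDyer.BirchSwinnertonDyer.Theorems.ManinLocalTwoThree.NeronSqueezeOneFortyFour

open EtaIdentitiesOneFortyFour

/-! ## §1 `144a1 = [0, 0, 0, 0, −1]` -/

/-- The literal `ℚ`-model `[0, 0, 0, 0, −1]` read through integer casts. [folklore] -/
theorem mk_oneFortyFourA1_eq_cast :
    (⟨0, 0, 0, 0, -1⟩ : WeierstrassCurve ℚ) = ⟨((0 : ℤ) : ℚ), ((0 : ℤ) : ℚ), ((0 : ℤ) : ℚ), ((0 : ℤ) : ℚ), ((-1 : ℤ) : ℚ)⟩ := by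
  ext <;> norm_num

/-- `144a1 = [0, 0, 0, 0, −1]` is globally minimal (`Δ = −2⁴·3³`; kernel certificate). [cite: SilvermanAEC2009, VII.1 Remark 1.1] -/
theorem isGloballyMinimal_oneFortyFourA1 : (⟨0, 0, 0, 0, -1⟩ : WeierstrassCurve ℚ).IsGloballyMinimal := by
  rw [mk_oneFortyFourA1_eq_cast]
  exact IntModelCond.isGloballyMinimal_mk_of_minCheck 0 0 0 0 (-1) (cm := ⟨4, 0, 5, [⟨3, 1, 3, 2, 0⟩]⟩) (by decide +kernel)

/-- `[0, 0, 0, 0, −1]` is an elliptic curve (`Δ = −432 ≠ 0`); a theorem, use `haveI`. [folklore] -/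
theorem isElliptic_oneFortyFourA1 : (⟨0, 0, 0, 0, -1⟩ : WeierstrassCurve ℚ).IsElliptic :=
  ⟨by norm_num [WeierstrassCurve.Δ, WeierstrassCurve.b₂, WeierstrassCurve.b₄, WeierstrassCurve.b₆, WeierstrassCurve.b₈]⟩

/-- **`N([0, 0, 0, 0, −1]) = 144 = 2⁴·3²`**: Step-3 certificates at `2` (`(r, s, t) = (0, 0, 1)` to `[0, 0, 2, 0, −2]`, `2 ∥ a₆`: type `II`, `f₂ = 4`)
and at `3` (`(r, s, t) = (1, 0, 0)` to `[0, 3, 0, 3, 0]`, `9 ∣ a₆`, `3² ∥ b₈`: type `III`, `f₃ = 2`); kernel-checked, minimality included.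
[cite: Silverman1994, IV.9.4] [cite: CremonaAlgorithms1997, Table 1 (144a1)] -/
theorem conductorNorm_oneFortyFourA1 : (⟨0, 0, 0, 0, -1⟩ : WeierstrassCurve ℚ).conductorNorm ℤ = 144 := by
  rw [mk_oneFortyFourA1_eq_cast]
  exact IntModelCond.conductorNorm_mk_eq_of_certs_of_eq 0 0 0 0 (-1)
    (cm := ⟨4, 0, 5, [⟨3, 1, 3, 2, 0⟩]⟩) (c := ⟨4, 0, 5, 3, 0, 3, []⟩)
    (l₂ := ⟨2, 0, 0, 1, 4, 2, 0⟩) (l₃ := ⟨2, 1, 0, 0, 3, 3, 2⟩)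
    (by decide +kernel) (by decide +kernel) (by decide +kernel) (by decide +kernel) (by decide +kernel)

/-- **The Néron invariants of `144a1`**: `c₄ = 0`, `c₆ = 864`; `(g₂, g₃) = (0, 4) ⟹ IsNeronLatticeOf`. [cite: CremonaAlgorithms1997, Table 1 (144a1)] -/
theorem isNeronLatticeOf_oneFortyFourA1 {L₁ : PeriodPair} (hg2 : L₁.g₂ = 0) (hg3 : L₁.g₃ = 4) :
    IsNeronLatticeOf ((⟨0, 0, 0, 0, -1⟩ : WeierstrassCurve ℚ).baseChange ℂ) L₁ := by
  constructor
  · rw [hg2]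
    norm_num [WeierstrassCurve.baseChange, WeierstrassCurve.map_c₄, WeierstrassCurve.c₄,
      WeierstrassCurve.b₂, WeierstrassCurve.b₄]
  · rw [hg3]
    norm_num [WeierstrassCurve.baseChange, WeierstrassCurve.map_c₆, WeierstrassCurve.c₆,
      WeierstrassCurve.b₂, WeierstrassCurve.b₄, WeierstrassCurve.b₆]

/-! ## §2 The squeeze for the class `144a` -/

/-- **`|c| = 1` for every `X₀(144)`-datum whose newform is `φ₁₄₄ₐ = η₁₂¹²/(η₆η₂₄)⁴`** — UNCONDITIONAL. [cite: AgasheRibetStein2006, §§1–2] -/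
theorem abs_maninConstant_eq_one_oneFortyFour_of_f_eq (W : WeierstrassCurve ℚ) [W.IsElliptic] [W.IsGloballyMinimal]
    (D : ModularParametrizationData W 144)
    (hf : ⇑D.f = etaQuotient 144 (expFn [(6, -4), (12, 12), (24, -4)]))
    (hopt : ∀ z ∈ D.L.lattice, ∃ w ∈ periodLattice D.f, z = D.c * w) :
    |D.maninConstant| = 1 := by
  haveI := isElliptic_oneFortyFourA1
  haveI := isGloballyMinimal_oneFortyFourA1
  obtain ⟨L₁, hg2, hg3, hle⟩ := periodLatticeLe_oneFortyFourA D.f hf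
  exact NeronSqueeze.abs_maninConstant_eq_one_of_periodLattice_le (⟨0, 0, 0, 0, -1⟩ : WeierstrassCurve ℚ) L₁
    (isNeronLatticeOf_oneFortyFourA1 hg2 hg3) W D hle hopt

/-- `2 ∤ c` and `3 ∤ c` for every `X₀(144)`-datum whose newform is `φ₁₄₄ₐ` — UNCONDITIONAL. [folklore] -/
theorem not_dvd_maninConstant_oneFortyFour_of_f_eq (W : WeierstrassCurve ℚ) [W.IsElliptic] [W.IsGloballyMinimal]
    (D : ModularParametrizationData W 144)
    (hf : ⇑D.f = etaQuotient 144 (expFn [(6, -4), (12, 12), (24, -4)]))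
    (hopt : ∀ z ∈ D.L.lattice, ∃ w ∈ periodLattice D.f, z = D.c * w) :
    ¬ (2 : ℤ) ∣ D.maninConstant ∧ ¬ (3 : ℤ) ∣ D.maninConstant := by
  have h := abs_maninConstant_eq_one_oneFortyFour_of_f_eq W D hf hopt
  refine ⟨fun h2 ↦ ?_, fun h3 ↦ ?_⟩
  · have := Int.le_of_dvd (by rw [h]; norm_num) ((dvd_abs _ _).mpr h2)
    rw [h] at this
    norm_num at this
  · have := Int.le_of_dvd (by rw [h]; norm_num) ((dvd_abs _ _).mpr h3)
    rw [h] at this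
    norm_num at this

/-- **Modularity at `144a1`, levelled**: under `exists_isNewformOf`, `[0, 0, 0, 0, −1]` has a newform in `S₂(Γ₀(144))`.  CONDITIONAL on the
items' own binder. [cite: DiamondShurman2005, Thm. 8.8.3] -/
theorem exists_isNewformOf_oneFortyFourA1 (hnf : exists_isNewformOf) :
    ∃ f : CuspForm (Gamma0 144) 2, IsNewformOf (⟨0, 0, 0, 0, -1⟩ : WeierstrassCurve ℚ) f := by
  haveI := isElliptic_oneFortyFourA1
  have key : ∀ (N : ℕ) [NeZero N], (⟨0, 0, 0, 0, -1⟩ : WeierstrassCurve ℚ).conductorNorm ℤ = N →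
      ∃ f : CuspForm (Gamma0 N) 2, IsNewformOf (⟨0, 0, 0, 0, -1⟩ : WeierstrassCurve ℚ) f := by
    intro N _ hN
    subst hN
    exact hnf _
  haveI : NeZero (144 : ℕ) := ⟨by decide⟩
  exact key 144 conductorNorm_oneFortyFourA1

end Summit.BirchSwinnertonDyer.BirchSwinnertonDyer.Theorems.ManinLocalTwoThree.NeronSqueezeOneFortyFour

end
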